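import Summits.BirchSwinnertonDyer.BirchSwinnertonDyer.Theorems.GenusKolyvaginAtTwoPowDvdShaCardAtTwoPosTGenusIndexLaw
import Summits.BirchSwinnertonDyer.BirchSwinnertonDyer.Theorems.GenusKolyvaginAtTwoPubInputsAtTwoDefs
import HarnessLib

/-!
# Route `GenusKolyvaginAtTwo`, LINE 19 v4.2 (L⁺_T `PowDvdShaCardAtTwoPosT`, stmt-BirchSwinnertonDyer-23379): registered stub K
# `stub_genusIndexLaw : PubInputsAtTwo → …` BY NAME AND SIGNATURE

Seat `bsd-line-gk2-p2` g14 (cell `bsd-f1-sign2`), `--supports stmt-BirchSwinnertonDyer-23379` (stub landing; closes nothing — the crux content is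
3a‴ `stub_twinLadderGenus`).  THEOREMS ONLY (no definition, no new named fact, no `sorry`); BSD is not proved by any of this.

The skeleton's stub K reads `PubInputsAtTwo → ‹genus index law on the Δ > 0 frame›`, with `PubInputsAtTwo` now a TREE definition
(`…Theorems.GenusExact.PlusDescent.PubInputsAtTwo`, gk2-p3 g17, `…PubInputsAtTwoDefs.lean`, body = the skeleton's verbatim: the route's
four displayed published items and, as second conjunct, `∀ N W K, kolyvagin N W K`).  This file states the stub with LITERALLY the
registered signature and proves it by `stub_genusIndexLawPos_of_kolyvagin h.2.1`
(`…PosTGenusIndexLaw.lean`, this seat; the Kolyvagin conjunct is itself derivable from the other conjuncts,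
`kolyvagin_of_grossZagier_of_rankEqAnalyticRank_of_entire`, `…KolyvaginOfPublishedInputs.lean`).  CONDITIONAL on `PubInputsAtTwo`
(the line's displayed published inputs), exactly as registered.
References: [DokchitserDokchitserAnnals2010] Conj. 2.1; [GrossLMS1991] Thm. 1.3; [Kramer1981] Prop. 3; [Pal2012] Prop. 2.5.
-/

set_option autoImplicit false
-- the Theorems namespace of this sub repeats the summit name by design (D-0017 nested layout)
set_option linter.dupNamespace false

noncomputable section

namespace Summit.BirchSwinnertonDyer.BirchSwinnertonDyer.Theorems.GenusExact.RegularPlusDescent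

open Summit.BirchSwinnertonDyer.BirchSwinnertonDyer.Theses.GenusKolyvaginAtTwo
open Summit.BirchSwinnertonDyer.BirchSwinnertonDyer.Theorems.GenusExact.PlusDescent

/-- **LINE 19 v4.2 registered stub K `stub_genusIndexLaw`, BY NAME AND SIGNATURE** (L⁺_T `PowDvdShaCardAtTwoPosT`, stmt-BirchSwinnertonDyer-23379): behind the line's
displayed bundle `PubInputsAtTwo`, on the `Δ > 0` genus frame the Ш-free BSD ratio `ρ = B(W)·B(Wd)/B(W_K)` is a non-zero rational with
`ord₂ ρ = ord₂ C(Wd)`.  Proof: the Kolyvagin conjunct `h.2.1` feeds `stub_genusIndexLawPos_of_kolyvagin` (regulator `1/2` from rank one and odd torsion,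
periods `n_W·Ω(W_K)` with Pal's `ũ = 1`, `C(W_K) = C(W)²`, odd torsion orders).  CONDITIONAL on `PubInputsAtTwo`.
[cite: DokchitserDokchitserAnnals2010, Conj. 2.1] [cite: GrossLMS1991, Thm. 1.3] [cite: Kramer1981, Prop. 3 and Thm. 1] [cite: Pal2012, Prop. 2.5] -/
theorem stub_genusIndexLaw :
    PubInputsAtTwo → ∀ (W : WeierstrassCurve ℚ) [W.IsElliptic] [W.IsGloballyMinimal] [NeZero (W.conductorNorm ℤ)], Odd W.tamagawaProduct → 0 < W.Δ → ∀ (K : Type) [Field K] [NumberField K], Literature.NumberTheory.EllipticCurves.IsImaginaryQuadratic K → Odd (NumberField.discr K) → NumberField.discr K ≠ -3 → Literature.NumberTheory.EllipticCurves.SatisfiesHeegnerHypothesis (W.conductorNorm ℤ) K → (∀ n : ℕ, 0 < n → W.HasSurjectiveModNGaloisRep ((2 : ℤ) ^ n)) → ∀ (Dt : Literature.NumberTheory.EllipticCurves.ModularForms.ModularParametrizationData W (W.conductorNorm ℤ)) (β : ℤ) (ι : K →+* ℂ) (d₁ : Literature.NumberTheory.EllipticCurves.KolyvaginHeegnerData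 Dt β ι 1), ¬ IsOfFinAddOrder d₁.derivedPoint → ∀ (Wd : WeierstrassCurve ℚ) [Wd.IsElliptic] [Wd.IsGloballyMinimal], (∃ C : WeierstrassCurve.VariableChange ℚ, C • W.quadraticTwist (NumberField.discr K : ℚ) = Wd) → ∃ q : ℚ, q ≠ 0 ∧ (q : ℝ) = (W.regulator * W.bsdPeriod * ((W.modifiedTamagawaProduct : ℚ) : ℝ) / ((W.torsionOrder : ℕ) : ℝ) ^ 2) * (Wd.regulator * Wd.bsdPeriod * ((Wd.modifiedTamagawaProduct : ℚ) : ℝ) / ((Wd.torsionOrder : ℕ) : ℝ) ^ 2) / ((W.baseChange K).regulator * (W.baseChange K).bsdPeriod * (((W.baseChange K).modifiedTamagawaProduct : ℚ) : ℝ) / (((W.baseChange K).torsionOrder : ℕ) : ℝ) ^ 2) ∧ padicValRat 2 q = (padicValNat 2 Wd.tamagawaProduct : ℤ) :=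
  fun h => stub_genusIndexLawPos_of_kolyvagin h.2.1

end Summit.BirchSwinnertonDyer.BirchSwinnertonDyer.Theorems.GenusExact.RegularPlusDescent

end
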